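import Summits.CriticalPhenomena.PercolationContinuityZ3.Theorems.SahiMasterFamilyStructIndep

/-!
# Structure theory of the zero-flag class, VII: shrinking (D) and structured families are zero flags

Unit `prim-master-conj` (crux anchor stmt-CriticalPhenomena-4575); STRUCTURE-THEORY.md §3.10–§3.11 (gen 6).
* **D (SHRINK)** `structured_update_inter_head`: if `m :: l₀` is a good chain (`m` last) and `t` is a member of `l₀`, then the family of
  `l₀` with `U t` replaced by `U t ∩ U m` is structured, the canonical frame of `t` becoming `A_t ∩ A_m` and the others unchanged.
* **EQ⊆** `suppZeroFlag_of_structured`: every structured family of size `≥ 2`, in ANY enumeration, is in the tree's recursive zero-flag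
  class `SuppZeroFlag` — hence (`sahiE_ind_eq_zero_of_suppZeroFlag`) has `E ≡ 0` under every product measure.
Pure combinatorics; axioms standard. [this work]
-/

noncomputable section

open scoped Classical

namespace Summit.CriticalPhenomena.PercolationContinuityZ3.Theorems

open Finset Function
open Literature.Probability.LatticeModels.Kahn2022 (Affects)
open Literature.Probability.Percolation (DeterminedBy)

variable {ι : Type*} [Fintype ι] {κ : Type*} (U : κ → Set (Set ι))

/-! ### D: shrinking a member by the last member -/

/-- **D (STRUCTURE-THEORY 3.10).**  For a good chain `m :: l₀` and `t ∈ l₀`, the family of `l₀` with `U t ↦ U t ∩ U m` is structured;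
the canonical frame of `t` becomes `(frame of t) ∩ (frame of m)` and the other canonical frames are unchanged. [this work] -/
theorem structured_update_inter_head (hU : ∀ k, IsUpperSet (U k)) (hne : ∀ k, (U k).Nonempty) {m : κ} {l₀ : List κ}
    (hl : GoodChain U (m :: l₀)) {t : κ} (ht : t ∈ l₀) :
    Structured (update U t (U t ∩ U m)) l₀.toFinset ∧
      cframe (update U t (U t ∩ U m)) l₀.toFinset t = cframe U l₀.toFinset t ∩ frameIn U (m :: l₀) m ∧
      ∀ w ∈ l₀, w ≠ t → cframe (update U t (U t ∩ U m)) l₀.toFinset w = cframe U l₀.toFinset w := by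
  set U' := update U t (U t ∩ U m) with hU'def
  set W := l₀.toFinset with hWdef
  set AM := frameIn U (m :: l₀) m with hAMdef
  have hl₀ : GoodChain U l₀ := GoodChain.tail U hl
  have hm : m ∉ l₀ := ((goodChain_cons U).1 hl).2.1
  have hNM : AM \ U m ⊆ Safe U W := by rw [hAMdef, frameIn_cons_self]; exact ((goodChain_cons U).1 hl).2.2
  have hW : Structured U W := ⟨l₀, rfl, hl₀⟩
  have htW : t ∈ W := List.mem_toFinset.2 ht
  have hU'u : ∀ k, IsUpperSet (U' k) := isUpperSet_update_inter_family U hU t (hU m)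
  have hU'ne : ∀ k, (U' k).Nonempty := nonempty_update_inter_family U hU hne t (hU m) (hne m)
  have hAMu : IsUpperSet AM := isUpperSet_frameIn U hU _ m
  have hAMm : U m ⊆ AM := subset_frameIn U hU _ m
  have hAt : cframe U W t = frameIn U l₀ t := (frameIn_eq_cframe U hU hne hl₀ ht).symm
  by_cases hWt : Structured U (W.erase t)
  · -- Case (a): `t` removable, hence last-able (SYM); put `U t ∩ U m` last over a chain of `W ∖ t`
    obtain ⟨l₂, hl₂W, hl₂⟩ := id hWt
    have htl₂ : GoodChain U (t :: l₂) := goodChain_cons_of_structured_erase U hU hne hW htW hl₂W hl₂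
    have htnot : t ∉ l₂ := ((goodChain_cons U).1 htl₂).2.1
    have hframe_t : hull (frameSupp U l₂) (U t) = cframe U W t := hull_frameSupp_erase U hU hne hW htW hl₂W hl₂
    have hagree : ∀ w ∈ l₂, U w = U' w := by
      intro w hw
      have hwt : w ≠ t := fun h => htnot (h ▸ hw)
      exact (update_inter_of_ne U (U m) hwt).symm
    have hS₂ : frameSupp U' l₂ = frameSupp U l₂ := (frameSupp_congr hagree).symm
    have hS₂sub : frameSupp U l₂ ⊆ frameSupp U l₀ :=
      frameSupp_subset_of_cframe_eq U hU hne hl₂ hl₀ (by rw [hl₂W]; exact erase_subset t W)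
        (fun w hw => by rw [hl₂W] at hw; rw [hl₂W]; exact cframe_erase U hU hne hW hWt hw)
    -- the new frame of `t`
    have hhull : hull (frameSupp U l₂) (U t ∩ U m) = cframe U W t ∩ AM := by
      rw [hull_inter, hframe_t]
      refine Set.Subset.antisymm (Set.inter_subset_inter_right _ ?_) fun ω hω => ⟨hω.1, ?_⟩
      · rw [hAMdef, frameIn_cons_self]; exact hull_mono_left (hU m) hS₂sub
      · -- `ω ∪ S₂` lies in every frame of `l₀`, so (T′) it is not annihilated by `m`
        rw [mem_hull]
        by_contra hωm
        have hω' : ω ∪ frameSupp U l₂ ∈ AM := hAMu Set.subset_union_left hω.2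
        have hsafe : ω ∪ frameSupp U l₂ ∈ Safe U W := hNM ⟨hω', hωm⟩
        have h2 := two_le_card_frameFail U l₀.length le_rfl hl₀ hU _ (Or.inl hsafe)
        have h0 : frameFail U l₀ (ω ∪ frameSupp U l₂) = ∅ := by
          refine eq_empty_of_forall_notMem fun w hw => ?_
          rw [mem_frameFail] at hw
          apply hw.2
          by_cases hwt : w = t
          · subst hwt
            rw [← hAt]
            exact isUpperSet_cframe U hU W w Set.subset_union_left hω.1
          · refine mem_of_esupp_subset (isUpperSet_frameIn U hU l₀ w) (frameIn_nonempty U hU hne l₀ w) fun i hi => ?_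
            refine Set.mem_union_right _ ?_
            rw [frameSupp_eq_biUnion_cframe U hU hne hl₂, hl₂W, Set.mem_iUnion₂]
            refine ⟨w, mem_erase.2 ⟨hwt, List.mem_toFinset.2 hw.1⟩, ?_⟩
            rwa [cframe_erase U hU hne hW hWt (mem_erase.2 ⟨hwt, List.mem_toFinset.2 hw.1⟩),
              ← frameIn_eq_cframe U hU hne hl₀ hw.1]
        rw [h0, Finset.card_empty] at h2
        omega
    -- the new chain is good
    have hgood : GoodChain U' (t :: l₂) := by
      rw [goodChain_cons]
      refine ⟨(goodChain_congr hagree).1 hl₂, htnot, ?_⟩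
      rw [hS₂, hU'def, update_self, hhull, ← hU'def,
        ← safe_congr (fun w hw => hagree w (List.mem_toFinset.1 hw)), hl₂W]
      intro φ hφ
      obtain ⟨⟨hφt, hφM⟩, hφn⟩ := hφ
      by_cases hφUt : φ ∈ U t
      · -- then `φ ∉ U m`: `φ` is annihilated by `m`, safe for `W`, and `t` does not fail
        have hφUm : φ ∉ U m := fun h => hφn ⟨hφUt, h⟩
        have hφs : φ ∈ Safe U W := hNM ⟨hφM, hφUm⟩
        obtain ⟨h2, hsup⟩ := (mem_safe U).1 hφs
        rw [mem_safe]
        have hfs : failSet U W φ ⊆ failSet U (W.erase t) φ := by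
          intro w hw
          rw [mem_failSet] at hw ⊢
          exact ⟨mem_erase.2 ⟨fun h => hw.2 (h ▸ hφUt), hw.1⟩, hw.2⟩
        exact ⟨h2.trans (card_le_card hfs), fun R h1 h2' => hsup R (hfs.trans h1) (h2'.trans (erase_subset t W))⟩
      · exact annihilator_subset_safe_erase U hU hne hW htW hWt ⟨hφt, hφUt⟩
    have hW' : Structured U' W := ⟨t :: l₂, by rw [List.toFinset_cons, hl₂W, insert_erase htW], hgood⟩
    have eT : (t :: l₂).toFinset = W := by rw [List.toFinset_cons, hl₂W, insert_erase htW]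
    refine ⟨hW', ?_, fun w hw hwt => ?_⟩
    · rw [← eT, ← frameIn_eq_cframe U' hU'u hU'ne hgood (List.mem_cons_self), frameIn_cons_self, hS₂, hU'def, update_self,
        hhull, eT]
    · have hw₂ : w ∈ l₂ := List.mem_toFinset.1 (by rw [hl₂W]; exact mem_erase.2 ⟨hwt, List.mem_toFinset.2 hw⟩)
      rw [← eT, ← frameIn_eq_cframe U' hU'u hU'ne hgood (List.mem_cons_of_mem t hw₂), frameIn_cons_of_ne U' hwt,
        ← frameIn_congr hagree hw₂, frameIn_eq_cframe U hU hne hl₂ hw₂, hl₂W, eT]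
      exact cframe_erase U hU hne hW hWt (mem_erase.2 ⟨hwt, List.mem_toFinset.2 hw⟩)
  · -- Case (b): `t` is not removable, hence pure, and `U m` does not cut into `U t`: Lemma I′ with `B := AM`
    have hpure : cframe U W t ⊆ U t := by
      by_contra h; exact hWt (structured_erase_of_not_subset U hU hne hW htW h)
    have hNt : ∀ φ ∈ AM, φ ∈ U t → φ ∈ U m := by
      intro φ hφA hφt
      by_contra hφm
      obtain ⟨-, hsup⟩ := (mem_safe U).1 (hNM ⟨hφA, hφm⟩)
      refine hWt (hsup _ (fun w hw => ?_) (erase_subset t W))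
      rw [mem_failSet] at hw
      exact mem_erase.2 ⟨fun h => hw.2 (h ▸ hφt), hw.1⟩
    have einter : U t ∩ U m = U t ∩ AM :=
      Set.Subset.antisymm (Set.inter_subset_inter_right _ hAMm) fun ω hω => ⟨hω.1, hNt ω hω.2 hω.1⟩
    have hdisj : Disjoint (↑(esupp AM) : Set ι) (frameSupp U l₀) :=
      (disjoint_frameSupp_esupp_frameIn_head U m l₀).symm
    obtain ⟨hgood, hft, hfo⟩ := goodChain_update_inter_of_disjoint U hU hne hAMu ((hne m).mono hAMm) l₀.length le_rfl hl₀ hdisj ht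
    rw [← einter] at hgood hft hfo
    refine ⟨⟨l₀, rfl, hgood⟩, ?_, fun w hw hwt => ?_⟩
    · rw [← frameIn_eq_cframe U' hU'u hU'ne hgood ht, hft, hAt]
    · rw [← frameIn_eq_cframe U' hU'u hU'ne hgood hw, hfo w hw hwt, frameIn_eq_cframe U hU hne hl₀ hw]

/-! ### Structured families are zero flags -/

/-- **EQ⊆ (STRUCTURE-THEORY 3.11): every structured family with at least two members, in any enumeration, lies in the recursive
zero-flag class `SuppZeroFlag`.** [this work] -/
theorem suppZeroFlag_of_structured : ∀ (k : ℕ) (U : κ → Set (Set ι)), (∀ x, IsUpperSet (U x)) → (∀ x, (U x).Nonempty) →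
    ∀ (V : Fin (k + 2) → κ), Injective V → Structured U (univ.image V) → SuppZeroFlag (k + 2) (fun j => U (V j))
  | 0, U, hU, hne, V, hV, hW => by
    have h01 : V 0 ≠ V 1 := fun h => absurd (hV h) (by decide)
    have hWeq : univ.image V = ({V 0, V 1} : Finset κ) := by
      ext x; simp only [mem_image, mem_univ, true_and, mem_insert, mem_singleton]
      constructor
      · rintro ⟨j, rfl⟩; fin_cases j <;> simp
      · rintro (rfl | rfl); exacts [⟨0, rfl⟩, ⟨1, rfl⟩]
    rw [hWeq] at hW
    obtain ⟨l, hlW, hln, hlen, hgl⟩ := Structured.exists_chain U hW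
    rw [card_pair h01] at hlen
    obtain ⟨a, b, rfl⟩ : ∃ a b, l = [a, b] := by
      match l, hlen with
      | [a, b], _ => exact ⟨a, b, rfl⟩
    have hab : a ≠ b := by intro h; subst h; simp at hln
    have hdisj : Disjoint (esupp (U a)) (esupp (U b)) := (goodChain_pair_iff U hU hab).1 hgl
    have hd01 : Disjoint (esupp (U (V 0))) (esupp (U (V 1))) := by
      have ha : a = V 0 ∨ a = V 1 := by
        have : a ∈ ({V 0, V 1} : Finset κ) := by rw [← hlW]; simp
        simpa using this
      have hb : b = V 0 ∨ b = V 1 := by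
        have : b ∈ ({V 0, V 1} : Finset κ) := by rw [← hlW]; simp
        simpa using this
      rcases ha with rfl | rfl
      · rcases hb with h | rfl
        · exact absurd h.symm hab
        · exact hdisj
      · rcases hb with rfl | h
        · exact hdisj.symm
        · exact absurd h.symm hab
    exact ⟨esupp (U (V 0)), esupp (U (V 1)), hd01, determinedBy_esupp (hU _), determinedBy_esupp (hU _)⟩
  | k + 1, U, hU, hne, V, hV, hW => by
    obtain ⟨c, hcW, hc⟩ := id hW
    match c, hcW, hc with
    | [], hcW, _ =>
      have : V 0 ∈ univ.image V := mem_image_of_mem V (mem_univ 0)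
      rw [← hcW] at this; simp at this
    | m :: c₀, hcW, hc =>
      have hm : m ∉ c₀ := ((goodChain_cons U).1 hc).2.1
      obtain ⟨i, hi⟩ : ∃ i, V i = m := by
        have : m ∈ univ.image V := by rw [← hcW]; simp
        simpa [mem_image] using this
      set V' : Fin (k + 2) → κ := fun j => V (i.succAbove j) with hV'def
      have hV' : Injective V' := fun a b h => Fin.succAbove_right_injective (hV h)
      have hV'img : univ.image V' = c₀.toFinset := by
        have e : (univ.image V).erase m = c₀.toFinset := by
          rw [← hcW, List.toFinset_cons, erase_insert (fun h => hm (List.mem_toFinset.1 h))]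
        rw [← e]
        ext x
        simp only [mem_image, mem_univ, true_and, mem_erase]
        constructor
        · rintro ⟨j, rfl⟩
          exact ⟨fun h => Fin.succAbove_ne i j (hV (h.trans hi.symm)), ⟨i.succAbove j, rfl⟩⟩
        · rintro ⟨hx, ⟨j, rfl⟩⟩
          have hji : j ≠ i := fun h => hx (by rw [h, hi])
          obtain ⟨j', rfl⟩ := Fin.exists_succAbove_eq hji
          exact ⟨j', rfl⟩
      have hc₀s : Structured U c₀.toFinset := ⟨c₀, rfl, GoodChain.tail U hc⟩
      refine ⟨i, ?_, fun l => ?_⟩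
      · exact suppZeroFlag_of_structured k U hU hne V' hV' (hV'img ▸ hc₀s)
      · -- the shrink at `t := V' l`
        have ht : V' l ∈ c₀ := List.mem_toFinset.1 (hV'img ▸ mem_image_of_mem V' (mem_univ l))
        obtain ⟨hst, -, -⟩ := structured_update_inter_head U hU hne hc ht
        have hU'u := isUpperSet_update_inter_family U hU (V' l) (hU m)
        have hU'ne := nonempty_update_inter_family U hU hne (V' l) (hU m) (hne m)
        have key := suppZeroFlag_of_structured k _ hU'u hU'ne V' hV' (hV'img ▸ hst)
        have e : (fun j => update U (V' l) (U (V' l) ∩ U m) (V' j)) =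
            update (fun j => U (V (i.succAbove j))) l (U (V (i.succAbove l)) ∩ U (V i)) := by
          funext j
          by_cases hjl : j = l
          · subst hjl; rw [update_self, update_self, hi]
          · rw [update_of_ne hjl, update_of_ne (fun h => hjl (hV' h))]
        rw [e] at key
        exact key

/-- **A good chain with at least two members is a zero flag; in particular its family has `E ≡ 0` under every product measure**
(STRUCTURE-THEORY Prop. 1). [this work] -/
theorem suppZeroFlag_of_goodChain (hU : ∀ k, IsUpperSet (U k)) (hne : ∀ k, (U k).Nonempty) {k : ℕ} (V : Fin (k + 2) → κ)
    (hV : Injective V) {l : List κ} (hlW : l.toFinset = univ.image V) (hl : GoodChain U l) :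
    SuppZeroFlag (k + 2) (fun j => U (V j)) :=
  suppZeroFlag_of_structured k U hU hne V hV ⟨l, hlW, hl⟩

end Summit.CriticalPhenomena.PercolationContinuityZ3.Theorems
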